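import Summits.CriticalPhenomena.PercolationContinuityZ3.Theorems.SahiMasterFamilyPointwiseMinorDomination
import Summits.CriticalPhenomena.PercolationContinuityZ3.Theorems.SahiMasterFamilyPointwiseCoordinateGluing

/-!
# Explicit minor domination along one coordinate: the model case `k = 2`, the order-3 endpoint form, and the reductions

Unit `prim-master-conj` (crux anchor stmt-CriticalPhenomena-4575, helper work), gen 18; memo
`run/shared/lean/prim/prim-l12/prim-master-conj/POINTWISE.md` §19.  Notation: `t = p_e`, `s = 1 − t`, `U^b = (secAt e b (U j))_j` the two
one-coordinate minors of an increasing family `U`, `E^b = E_k(μ_p; 1_{U^b})`.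

THE EXPLICIT MINOR-DOMINATION SCHEMA `MD_k` (this generation's sharpening of gen 15's free-constant schema; CONJECTURAL for `k ≥ 3`):
  `E_k(μ_p; 1_U) ≥ (1 − p_e)^{k−1} · E_k(μ_p; 1_{U^{e←0}}) + p_e^{k−1} · E_k(μ_p; 1_{U^{e←1}})`   for every increasing `U`, every `e`, every `p`.
Evidence (exact arithmetic, gen 18): 0 violations over all triples of up-sets on `≤ 4` coordinates × all coordinates × 7 parameter vectors, random
families `k ≤ 5` on `≤ 7` coordinates and `> 5·10⁶` adversarial evaluations; the exponent `k − 1` on the `0`-minor is attained at `k = 3`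
(equality `E = s²E⁰` off zero flags, OR-shapes), the chord (`k − 1 ↦ 1`) fails in 5–8 % of random triples (gen 14's hexagon), and the
exponent `1` on the `1`-minor fails already for `0`-minors in `Z_3` beyond pinning (memo §19: `E_3(U) < p_e·E_3(U^{e←1})` with `U^{e←0} ∈ Z_3`).

CONTENT (all proved, axioms standard):
* `sahiE_two_sub_minors_eq` — THE MODEL CASE `k = 2` (an identity): `E_2(U) − s·E_2(U⁰) − t·E_2(U¹) = s t·ν_0 ν_1` (`ν_j = μ(U_j¹) − μ(U_j⁰) ≥ 0`),
  so `MD_2` holds with exponent `1 = k − 1` (`sahiE_two_ge_minors`).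
* `sahiE_three_sub_sq_minors_eq` — ORDER 3: `E − s²E⁰ − t²E¹ = s t·[ s·(mixC1_e − E⁰) + t·(mixC2_e − E¹) ]` (P3's one-coordinate Bernstein form), hence
  `MD_3` at `(U, e)` for EVERY `p_e` ⟺ the two ENDPOINT inequalities `mixC1_e(U) ≥ E_3(U^{e←0})`, `mixC2_e(U) ≥ E_3(U^{e←1})`
  (`sahiE_three_ge_sq_minors_of_mixC_ge`) — a sharpening of P3/gen 14's `H(1,3)` (`mixC ≥ 0`): in degree-3 Bernstein language
  `3B_1 ≥ B_0`, `3B_2 ≥ B_3` on top of `B_1, B_2 ≥ 0`.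
* REDUCTIONS (every order): `masterFamilyNonneg_of_explicitDomination` — `MD_{n+2}` everywhere ⟹ Sahi's `C_{n+2}` for product measures
  (`n = 1`: Kahn's Conjecture 5), by gen 15's `masterFamilyNonneg_of_minorDomination`; `masterFamilyEqIff_of_explicitDomination` (`k ≤ 7`,
  interior parameters) — ⟹ the pointwise master conjecture; order 3 from the endpoint inequalities
  (`masterFamilyNonneg_three_of_mixC_ge_minors`, `masterFamilyEqIff_three_of_mixC_ge_minors`).
HONEST FRAMING: identities and reductions only; `MD_k` (k ≥ 3), `C_k`, `MasterFamilyEqIff k` remain OPEN. [this work]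
-/

noncomputable section

open scoped Classical

namespace Summit.CriticalPhenomena.PercolationContinuityZ3.Theorems

open Finset Function
open Literature.Combinatorics.Sahi2008
open Literature.Probability.Percolation.DecisionTree (ind)
open SahiCombMix

namespace Pointwise

variable {ι : Type} [Fintype ι]

/-! ### 1. The model case `k = 2`: the law of total covariance along a coordinate -/

/-- **`E_2` along one coordinate** (law of total covariance for a product measure):
`Cov(U_0, U_1) = (1−t)·Cov(U_0⁰, U_1⁰) + t·Cov(U_0¹, U_1¹) + t(1−t)·ν_0 ν_1`, `ν_j = μ(U_j¹) − μ(U_j⁰)`. [folklore] -/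
theorem sahiE_two_sub_minors_eq (e : ι) (U : Fin 2 → Set (Set ι)) (p : ι → unitInterval) :
    sahiE (bernoulliWeight p) 2 (fun j => ind (U j))
      - (1 - (p e : ℝ)) * sahiE (bernoulliWeight p) 2 (fun j => ind (secAt e false (U j)))
      - (p e : ℝ) * sahiE (bernoulliWeight p) 2 (fun j => ind (secAt e true (U j)))
    = (p e : ℝ) * (1 - (p e : ℝ)) *
      ((ex (bernoulliWeight p) (ind (secAt e true (U 0))) - ex (bernoulliWeight p) (ind (secAt e false (U 0)))) *
        (ex (bernoulliWeight p) (ind (secAt e true (U 1))) - ex (bernoulliWeight p) (ind (secAt e false (U 1))))) := by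
  simp only [sahiE_two_apply]
  have h01 : ind (U 0) * ind (U 1) = ind (U 0 ∩ U 1) := by
    funext ω; simp [Literature.Probability.Percolation.BHK2006.ind_inter]
  have h01f : ind (secAt e false (U 0)) * ind (secAt e false (U 1)) = ind (secAt e false (U 0 ∩ U 1)) := by
    funext ω; simp [Literature.Probability.Percolation.BHK2006.ind_inter, secAt_inter]
  have h01t : ind (secAt e true (U 0)) * ind (secAt e true (U 1)) = ind (secAt e true (U 0 ∩ U 1)) := by
    funext ω; simp [Literature.Probability.Percolation.BHK2006.ind_inter, secAt_inter]
  rw [h01, h01f, h01t, ex_ind_eq_secAt p e (U 0 ∩ U 1), ex_ind_eq_secAt p e (U 0), ex_ind_eq_secAt p e (U 1)]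
  ring

/-- **`MD_2` (exponent `1`)**: `(1−p_e)·E_2(U^{e←0}) + p_e·E_2(U^{e←1}) ≤ E_2(U)` for increasing `U_0, U_1`. [folklore] -/
theorem sahiE_two_ge_minors (e : ι) (U : Fin 2 → Set (Set ι)) (hU : ∀ j, IsUpperSet (U j)) (p : ι → unitInterval) :
    (1 - (p e : ℝ)) * sahiE (bernoulliWeight p) 2 (fun j => ind (secAt e false (U j)))
      + (p e : ℝ) * sahiE (bernoulliWeight p) 2 (fun j => ind (secAt e true (U j)))
      ≤ sahiE (bernoulliWeight p) 2 (fun j => ind (U j)) := by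
  have h := sahiE_two_sub_minors_eq e U p
  have ht0 : 0 ≤ (p e : ℝ) := (p e).2.1
  have ht1 : 0 ≤ 1 - (p e : ℝ) := sub_nonneg.2 (p e).2.2
  have n0 := ex_secAt_true_sub_false_nonneg p e (hU 0)
  have n1 := ex_secAt_true_sub_false_nonneg p e (hU 1)
  nlinarith [mul_nonneg (mul_nonneg ht0 ht1) (mul_nonneg n0 n1)]

/-! ### 2. Order 3: the explicit form along a coordinate and the two endpoint inequalities -/

/-- **`E_3 − (1−t)²E_3(U⁰) − t²E_3(U¹)` along a coordinate**: `= t(1−t)·[(1−t)(mixC1 − E⁰) + t(mixC2 − E¹)]` (from P3's one-coordinate Bernstein form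
`E = (1−t)³E⁰ + t(1−t)²mixC1 + t²(1−t)mixC2 + t³E¹`, `sahiE_three_bernstein_secAt`). [this work] -/
theorem sahiE_three_sub_sq_minors_eq (e : ι) (U : Fin 3 → Set (Set ι)) (hU : ∀ j, IsUpperSet (U j)) (p : ι → unitInterval) :
    sahiE (bernoulliWeight p) 3 (fun j => ind (U j))
      - (1 - (p e : ℝ)) ^ 2 * sahiE (bernoulliWeight p) 3 (fun j => ind (secAt e false (U j)))
      - (p e : ℝ) ^ 2 * sahiE (bernoulliWeight p) 3 (fun j => ind (secAt e true (U j)))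
    = (p e : ℝ) * (1 - (p e : ℝ)) *
      ((1 - (p e : ℝ)) * (mixC1 (bernoulliWeight p) (fun j => secAt e false (U j)) (fun j => secAt e true (U j))
          - sahiE (bernoulliWeight p) 3 (fun j => ind (secAt e false (U j))))
        + (p e : ℝ) * (mixC2 (bernoulliWeight p) (fun j => secAt e false (U j)) (fun j => secAt e true (U j))
          - sahiE (bernoulliWeight p) 3 (fun j => ind (secAt e true (U j))))) := by
  rw [sahiE_three_bernstein_secAt e U hU p]
  ring

/-- **`MD_3` at `(U, e, p)` from the two endpoint inequalities** `mixC1_e ≥ E_3(U^{e←0})`, `mixC2_e ≥ E_3(U^{e←1})`: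
`(1−p_e)²·E_3(U^{e←0}) + p_e²·E_3(U^{e←1}) ≤ E_3(U)`. [this work] -/
theorem sahiE_three_ge_sq_minors_of_mixC_ge (e : ι) (U : Fin 3 → Set (Set ι)) (hU : ∀ j, IsUpperSet (U j)) (p : ι → unitInterval)
    (h1 : sahiE (bernoulliWeight p) 3 (fun j => ind (secAt e false (U j)))
      ≤ mixC1 (bernoulliWeight p) (fun j => secAt e false (U j)) (fun j => secAt e true (U j)))
    (h2 : sahiE (bernoulliWeight p) 3 (fun j => ind (secAt e true (U j)))
      ≤ mixC2 (bernoulliWeight p) (fun j => secAt e false (U j)) (fun j => secAt e true (U j))) :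
    (1 - (p e : ℝ)) ^ 2 * sahiE (bernoulliWeight p) 3 (fun j => ind (secAt e false (U j)))
      + (p e : ℝ) ^ 2 * sahiE (bernoulliWeight p) 3 (fun j => ind (secAt e true (U j)))
      ≤ sahiE (bernoulliWeight p) 3 (fun j => ind (U j)) := by
  have h := sahiE_three_sub_sq_minors_eq e U hU p
  have ht0 : 0 ≤ (p e : ℝ) := (p e).2.1
  have ht1 : 0 ≤ 1 - (p e : ℝ) := sub_nonneg.2 (p e).2.2
  have key : 0 ≤ (p e : ℝ) * (1 - (p e : ℝ)) *
      ((1 - (p e : ℝ)) * (mixC1 (bernoulliWeight p) (fun j => secAt e false (U j)) (fun j => secAt e true (U j))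
          - sahiE (bernoulliWeight p) 3 (fun j => ind (secAt e false (U j))))
        + (p e : ℝ) * (mixC2 (bernoulliWeight p) (fun j => secAt e false (U j)) (fun j => secAt e true (U j))
          - sahiE (bernoulliWeight p) 3 (fun j => ind (secAt e true (U j))))) :=
    mul_nonneg (mul_nonneg ht0 ht1) (add_nonneg (mul_nonneg ht1 (sub_nonneg.2 h1)) (mul_nonneg ht0 (sub_nonneg.2 h2)))
  linarith

/-! ### 3. The reductions: explicit domination ⟹ `C_k`; ⟹ the pointwise master conjecture (`k ≤ 7`) -/

/-- **`MD_{n+2}` everywhere ⟹ Sahi's `C_{n+2}` for product measures** (closed cube; `n = 1`: Kahn's Conjecture 5 for product measures).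
The explicit constants `(1−p_e)^{n+1}, p_e^{n+1} ≥ 0` are a special case of gen 15's free-constant domination. [this work] -/
theorem masterFamilyNonneg_of_explicitDomination (n : ℕ)
    (hMD : ∀ (κ : Type) [Fintype κ] (p : κ → unitInterval) (U : Fin (n + 2) → Set (Set κ)), (∀ j, IsUpperSet (U j)) →
      ∀ e : κ, (1 - (p e : ℝ)) ^ (n + 1) * sahiE (bernoulliWeight p) (n + 2) (fun j => ind (secAt e false (U j)))
        + (p e : ℝ) ^ (n + 1) * sahiE (bernoulliWeight p) (n + 2) (fun j => ind (secAt e true (U j)))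
        ≤ sahiE (bernoulliWeight p) (n + 2) (fun j => ind (U j))) :
    MasterFamilyNonneg (n + 2) :=
  masterFamilyNonneg_of_minorDomination n fun κ _ p U hU e =>
    ⟨(1 - (p e : ℝ)) ^ (n + 1), (p e : ℝ) ^ (n + 1), pow_nonneg (sub_nonneg.2 (p e).2.2) _, pow_nonneg (p e).2.1 _, hMD κ p U hU e⟩

/-- **`MD_k` at interior parameters ⟹ `MasterFamilyEqIff k`** (the pointwise master conjecture), every `k ≤ 7`. [this work] -/
theorem masterFamilyEqIff_of_explicitDomination {k : ℕ} (hk : k ≤ 7)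
    (hMD : ∀ (κ : Type) [Fintype κ] (p : κ → unitInterval), (∀ e, (p e : ℝ) ∈ Set.Ioo (0 : ℝ) 1) →
      ∀ U : Fin k → Set (Set κ), (∀ j, IsUpperSet (U j)) → ∀ e : κ,
        (1 - (p e : ℝ)) ^ (k - 1) * sahiE (bernoulliWeight p) k (fun j => ind (secAt e false (U j)))
          + (p e : ℝ) ^ (k - 1) * sahiE (bernoulliWeight p) k (fun j => ind (secAt e true (U j)))
          ≤ sahiE (bernoulliWeight p) k (fun j => ind (U j))) :
    MasterFamilyEqIff k :=
  masterFamilyEqIff_of_minorDomination hk fun κ _ p hp U hU e =>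
    ⟨(1 - (p e : ℝ)) ^ (k - 1), (p e : ℝ) ^ (k - 1), pow_pos (sub_pos.2 (hp e).2) _, pow_pos (hp e).1 _, hMD κ p hp U hU e⟩

/-- **Order 3 from the endpoint inequalities (closed cube)**: if `mixC1_e(U) ≥ E_3(U^{e←0})` and `mixC2_e(U) ≥ E_3(U^{e←1})` for every increasing triple
on every finite cube, every coordinate and every parameter, then `MasterFamilyNonneg 3` (Kahn's Conjecture 5 for product measures). [this work] -/
theorem masterFamilyNonneg_three_of_mixC_ge_minors
    (h : ∀ (κ : Type) [Fintype κ] (p : κ → unitInterval) (U : Fin 3 → Set (Set κ)), (∀ j, IsUpperSet (U j)) → ∀ e : κ,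
      sahiE (bernoulliWeight p) 3 (fun j => ind (secAt e false (U j)))
          ≤ mixC1 (bernoulliWeight p) (fun j => secAt e false (U j)) (fun j => secAt e true (U j)) ∧
        sahiE (bernoulliWeight p) 3 (fun j => ind (secAt e true (U j)))
          ≤ mixC2 (bernoulliWeight p) (fun j => secAt e false (U j)) (fun j => secAt e true (U j))) :
    MasterFamilyNonneg 3 :=
  masterFamilyNonneg_of_explicitDomination 1 fun κ _ p U hU e => by
    simpa using sahiE_three_ge_sq_minors_of_mixC_ge e U hU p (h κ p U hU e).1 (h κ p U hU e).2

/-- **Order 3 from the endpoint inequalities (open cube)**: the same hypothesis at interior parameters gives the pointwise master conjecture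
`MasterFamilyEqIff 3` (`E_3(μ_p; 1_U) = 0 ↔ U ∈ Z_3`, which contains Kahn's Conjecture 5 in strict form). [this work] -/
theorem masterFamilyEqIff_three_of_mixC_ge_minors
    (h : ∀ (κ : Type) [Fintype κ] (p : κ → unitInterval), (∀ e, (p e : ℝ) ∈ Set.Ioo (0 : ℝ) 1) →
      ∀ U : Fin 3 → Set (Set κ), (∀ j, IsUpperSet (U j)) → ∀ e : κ,
        sahiE (bernoulliWeight p) 3 (fun j => ind (secAt e false (U j)))
            ≤ mixC1 (bernoulliWeight p) (fun j => secAt e false (U j)) (fun j => secAt e true (U j)) ∧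
          sahiE (bernoulliWeight p) 3 (fun j => ind (secAt e true (U j)))
            ≤ mixC2 (bernoulliWeight p) (fun j => secAt e false (U j)) (fun j => secAt e true (U j))) :
    MasterFamilyEqIff 3 :=
  masterFamilyEqIff_of_explicitDomination (by norm_num) fun κ _ p hp U hU e => by
    simpa using sahiE_three_ge_sq_minors_of_mixC_ge e U hU p (h κ p hp U hU e).1 (h κ p hp U hU e).2

end Pointwise

end Summit.CriticalPhenomena.PercolationContinuityZ3.Theorems

end
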